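import Literature.NumberTheory.Transcendental.BrownMotivicMZV
import HarnessLib

/-!
# Existence of Brown's motivic MZV package (named fact) and periods.S24 modulo it

Topic `Literature/NumberTheory/Transcendental`. The structure `Brown2012.MotivicMZV`
(`BrownMotivicMZV.lean`) transcribes, field by field, the statements PRINTED in F. Brown,
*Mixed Tate motives over ℤ*, Ann. of Math. 175 (2012), §2 and §3.1, about the graded algebra
`H` of motivic multiple zeta values: the weight grading and `Iᵐ(0;u;1) ∈ H_{|u|}` ((2.16), I0,
I1), the period map `per : H → ℝ` with `per ζᵐ(n₁,…,n_r) = ζ(n₁,…,n_r)` ((2.11), (2.19)), the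
weight-preserving injection `φ : H ↪ 𝒰 = ℚ⟨f₃,f₅,…⟩ ⊗ ℚ[f₂]` ((2.15) with (2.22)), the contracted
derivations `∂ʰ_{2r+1}` of Definition 3.1 with (3.3), Goncharov's coaction formula (3.4)
(Theorem 2.4 = Goncharov 2005, Thm. 1.2), (3.1) and the relation (3.8).  Every one of these is a
theorem about the category `MT(ℤ)` of mixed Tate motives over `ℤ` (Deligne–Goncharov 2005) and
its motivic fundamental group; none is available in Mathlib, so the EXISTENCE of such a package
is recorded here as one named fact of size XL,

* `Brown2012.motivicMZV_nonempty : Prop := Nonempty Brown2012.MotivicMZV`,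

and the two `periods.S24` named facts of `MultipleZetaValues.lean` are reduced to it in one
line each, through the accepted reductions of `BrownMotivicMZV.lean`:

* `hoffmanSpan_eq_mzvSpace_of_motivicMZV_nonempty` — Brown 2012, Thm. 1.1 (Hoffman's
  conjecture: the `ζ(w)`, `w ∈ {2,3}^×`, span `𝒵_N`);
* `finrank_mzvSpace_le_zagierDim_of_motivicMZV_nonempty` — Terasoma / Deligne–Goncharov,
  `dim 𝒵_N ≤ d_N`.

So the trust base of both S24 facts is exactly `{Brown2012.motivicMZV_nonempty}` (net named-fact
accounting: two XL leaves become one apex).  Requested by the S24 prove seats (promote event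
1935257, 2026-08-15), which may not mint named facts themselves (D-0026).

Deliberately NOT here: any construction of `H` (it IS the content of the fact; the construction
of `H` FROM the Deligne–Goncharov input lives in the sibling files listed under *Proof status*),
uniqueness or normalisation questions (`MotivicMZV.normalize` in `BrownMotivicMZV.lean`), and the
discharges `hoffmanSpan_eq_mzvSpace_holds` / `finrank_mzvSpace_le_zagierDim_holds`, which would
assert the fact.

## Proof status (provefact seat, 2026-08-17): not discharged — XL; reduced to ONE Deligne–Goncharov input

Statement re-read against the materialised arXiv:1102.1312 (§§2.1–2.5, §3.1: Def. 2.1, 2.4, 3.1,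
(2.7)–(2.22), (3.1)–(3.4), (3.8)) and every field of `MotivicMZV` audited against it: faithful as
printed, neither mis-stated nor an open problem (Brown's §2 rests on [DeligneGoncharov2005, §§1–2,
§5] and [Goncharov2005, Thm 1.2]).  Why there is no `_holds`, and what IS proved:

* *Everything below the theory of mixed Tate motives is a theorem of the tree* (13 accepted files
  of this topic, ~6 950 lines, no `sorry`, no named fact): `ShuffleMonoidAlgebra` (the algebras
  `𝒰`, `𝒰 ⊗ 𝒰` as shuffle monoid algebras); `BrownMotivicGaloisData` (Brown §§2.1–2.5, §3.1 and
  Thm 2.4 from a coaction-level hypothesis bundle: `MotivicGaloisData.toMotivicMZV`,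
  `motivicMZV_nonempty_of_galoisData`); `GoncharovCoactionMultiplicative`,
  `GoncharovConvAssociative`, `BrownMotivicCoactionCoassociative` (Goncharov's coproduct is
  multiplicative and coassociative — [Goncharov2005, Thm 1.2, Prop. 2.2] —
  `motivicMZV_nonempty_of_coalgebraMap`); `BrownMotivicPeriodPoint` (Brown's `dch` (2.2), a shuffle
  character with `dch(ρ(s)) = ζ(s)`, `motivicMZV_nonempty_of_comparison`); `BrownIharaCoaction`,
  `BrownMotivicOrbit`, `BrownIharaGroupLaw`, `BrownMotivicOrbitPoint` (Goncharov's formula = Ihara's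
  group law [DeligneGoncharov2005, 5.11–5.12, (5.15.1)], Brown's (2.12) at points,
  `motivicMZV_nonempty_of_pointOrbit`); `IharaDerivationAlgebra`, `BrownMotivicOrbitGenerators`
  (freeness of `Lie G_𝒰` made constructive: ANY family of homogeneous rational Lie polynomials
  `σ_{2i+1}` integrates, through the infinitesimal Ihara action, to a graded shuffle character
  `ρgen σ : 𝒪(₀Π₁) → 𝒰'` Ihara-homomorphic at all points — `motivicMZV_nonempty_of_lieGenerators`);
  `DrinfeldAssociatorMotivicOrbit` (the residual input as ONE hypothesis bundle
  `DeligneGoncharov2005.MotivicOrbitWitness`, the data-level construction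
  `MotivicOrbitWitness.toMotivicMZV : MotivicMZV`, and
  `Brown2012.motivicMZV_nonempty_of_nonempty_motivicOrbitWitness`).
* *The single remaining input* is therefore `Nonempty DeligneGoncharov2005.MotivicOrbitWitness`:
  there are rational homogeneous Lie polynomials `σ₃, σ₅, σ₇, …` (images of free generators of
  `Lie G_𝒰` — [DeligneGoncharov2005, 1.6, (2.1.2)–(2.1.3), Prop. 2.2–2.3] with Borel's ranks of
  `K_{2n-1}(ℤ) ⊗ ℚ`), an even rational point `γ ∈ ₀Π₁(ℚ)` and a real point `(a, t₀)` of
  `G_𝒰 × 𝔸¹` with `dch = (a ∘ ρgen σ) ⋆ τ(√t₀).γ` — [BrownMTM2012, §2.3 (2.12)];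
  [DeligneGoncharov2005, 5.16, 5.19–5.20, Thm. 5.24].  It is the theorem of Deligne–Goncharov
  itself (the Tannakian category `MT(ℤ)`, Borel, the motivic `π₁` of `ℙ¹ ∖ {0,1,∞}` with tangential
  base points and its Betti–de Rham comparison), none of which exists in Mathlib or `Literature/`;
  its named-fact form (`DeligneGoncharov2005.dch_mem_motivicOrbit := Nonempty MotivicOrbitWitness`,
  one line over that file) can only be vendored by a librarian/operator (promote request 4423445),
  after which `motivicMZV_nonempty_holds := motivicMZV_nonempty_of_nonempty_motivicOrbitWitness ‹_›`.
* *No cheaper road.*  Any inhabitant of `MotivicMZV` — indeed any `MotivicOrbitWitness` — yields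
  `dim_ℚ 𝒵_N ≤ d_N` for REAL multiple zeta values (`finrank_mzvSpace_le_zagierDim_of_motivicMZV`),
  all of whose published proofs (Terasoma 2002, Deligne–Goncharov 2005, Brown 2012) are motivic;
  the non-motivic candidates (`H := 𝒵` with `per = id`: the period conjecture; formal double
  shuffle / `DMR₀`: `dim ≤ d_N` open; the cofree model `H := 𝒰`: rationality of the constants of
  integration in every weight = the same bound) each fail exactly at (`per`, `φ` injective).
* *Evidence of coherence* (seat folder `audit/`): Brown's decomposition algorithm run in the tree's
  exact conventions on genuine 110-digit regularised iterated integrals satisfies every field of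
  `MotivicMZV` on all 16 382 binary words of weight `≤ 13` and reproduces [Brown 2012b, §6]
  (`∂₅ζᵐ(3,5) = -5ζᵐ(3)`, the coordinates of `ζᵐ(4,3,3)`); and the residual orbit identity holds,
  with RATIONAL `σ_n`, `γ` read off that model, on all 16 383 words of weight `≤ 13` to `10⁻¹⁰⁴`.

## References

* F. Brown, *Mixed Tate motives over ℤ*, Ann. of Math. 175 (2012) 949–976 = arXiv:1102.1312,
  §2 (Def. 2.1, (2.11), Thm. 2.4, (2.15), (2.16), (2.19), (2.22)), §3.1 (Def. 3.1, (3.1),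
  (3.3), (3.4), (3.8)), Thm. 1.1. [BrownMTM2012]
* F. Brown, *On the decomposition of motivic multiple zeta values*, in: Galois–Teichmüller
  theory and arithmetic geometry, Adv. Stud. Pure Math. 63 (2012) 31–58 = arXiv:1102.1310, §6
  (the numerical examples quoted under *Proof status*). [Brown 2012b]
* P. Deligne, A. B. Goncharov, *Groupes fondamentaux motiviques de Tate mixte*, Ann. Sci. ÉNS
  38 (2005) 1–56; arXiv:math/0302267: 1.6, (2.1.2)–(2.1.3), Prop. 2.2–2.3, 5.11–5.12, (5.15.1),
  5.16, 5.19–5.20, Thm. 5.24, Cor. 5.25. [DeligneGoncharov2005]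
* A. B. Goncharov, *Galois symmetries of fundamental groupoids and noncommutative geometry*,
  Duke Math. J. 128 (2005) 209–284, Thm. 1.2. [Goncharov2005]
-/

namespace Literature.NumberTheory.Transcendental

namespace Brown2012

/-- **Brown's motivic MZV package exists** (named fact, size XL).  There is a graded commutative
`ℚ`-algebra `H` (motivic multiple zeta values, Brown 2012, Def. 2.1, built from the motivic
fundamental groupoid of `ℙ¹ ∖ {0,1,∞}` in the Tannakian category `MT(ℤ)` of Deligne–Goncharov
2005) carrying elements `Iᵐ(0;u;1) ∈ H_{|u|}` with I0, I1 ((2.16), §2.4), a period homomorphism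
`per : H → ℝ` with `per ζᵐ(n₁,…,n_r) = ζ(n₁,…,n_r)` ((2.11), (2.19)), a weight-preserving
injection `φ : H ↪ 𝒰` ((2.15), (2.22)), and for `r ≥ 1` derivations `∂ʰ_{2r+1} : H → H`
(Def. 3.1, (3.3)) intertwined by `φ` with `∂_{2r+1}` on `𝒰`, acting on `Iᵐ(0;v;1)` by Goncharov's
formula (3.4) (Thm. 2.4), with (3.1) and (3.8) — i.e. an inhabitant of the structure
`Brown2012.MotivicMZV`, whose fields are these printed statements verbatim.
[cite: BrownMTM2012, §2 (Def. 2.1, Thm. 2.4, (2.15), (2.22)) and §3.1 (Def. 3.1)] -/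
def motivicMZV_nonempty : Prop := Nonempty MotivicMZV

end Brown2012

/-- **Hoffman's conjecture (Brown 2012, Thm. 1.1) modulo the existence of the motivic package**:
the named fact `hoffmanSpan_eq_mzvSpace` (`MultipleZetaValues.lean`, periods.S24) follows from
`Brown2012.motivicMZV_nonempty` by the accepted reduction `hoffmanSpan_eq_mzvSpace_of_motivicMZV`.
[cite: BrownMTM2012, Theorem 1.1 and §7.2] -/
theorem hoffmanSpan_eq_mzvSpace_of_motivicMZV_nonempty (h : Brown2012.motivicMZV_nonempty) :
    hoffmanSpan_eq_mzvSpace :=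
  h.elim hoffmanSpan_eq_mzvSpace_of_motivicMZV

/-- **`dim 𝒵_N ≤ d_N` modulo the existence of the motivic package**: the named fact
`finrank_mzvSpace_le_zagierDim` (`MultipleZetaValues.lean`, periods.S24) follows from
`Brown2012.motivicMZV_nonempty` by the accepted reduction
`finrank_mzvSpace_le_zagierDim_of_motivicMZV`. [cite: BrownMTM2012, (7.2) and Corollary 7.5] -/
theorem finrank_mzvSpace_le_zagierDim_of_motivicMZV_nonempty (h : Brown2012.motivicMZV_nonempty) :
    finrank_mzvSpace_le_zagierDim :=
  h.elim finrank_mzvSpace_le_zagierDim_of_motivicMZV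

end Literature.NumberTheory.Transcendental
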